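import Mathlib
import Summits.NavierStokesRegularity.NavierStokesRegularity.Theorems.EulerZoomLiouvillePowerGaugeEulerLiouvilleHoopSliceChart
import Summits.NavierStokesRegularity.NavierStokesRegularity.Theorems.EulerZoomLiouvillePowerGaugeEulerLiouvilleHoopSliceFrame
import Literature.Analysis.FluidPDE.Wei2016FarFieldPointwise
import HarnessLib

/-!
# HOOP LINE, K-HOOP assembly (c)(ii), part 2 — THE TWO SIDES OF THE HOOP INEQUALITY IN THE SLICE CHART
# (route `EulerZoomLiouville`, crux E = stmt-NavierStokesRegularity-19832; class-free calculus, `--supports` only)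

Continuation of `…HoopSliceChart` (the smooth frame `R_θe₀, R_θe₁, e_z` along `axisPt σ t θ`, the slice components
`a = ⟪V∘axisPt, R_θe₀⟫`, `b = ⟪V∘axisPt, R_θe₁⟫`, `c = V_z∘axisPt` and their derivative laws).  Here: the two sides of
`HoopCore.HoopInequality` written in that chart, in exactly the shapes ns-ezl-w2 g5's `HoopCore.hoop_slice_le` (`…HoopRadialModes`)
consumes and produces:

* `thetaColumn_chart_eq` — `t⁻¹ ∫₀^{2π} [(aθ − b)² + (bθ + a)²] = t ∫₀^{2π} [⟪DV R_θe₁, R_θe₀⟫² + ⟪DV R_θe₁, R_θe₁⟫²]` (every `t`);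
* `sliceLHS_integrand_eq`, `norm_sliceLHS_integrand_le` — the hoop integrand of one circle is `∫ t · hoopDensity` (`t > 0`), bounded
  by `2π C` under ns-ezl-w3 g6's `t·|hoopDensity| ≤ C`;
* **`setIntegral_hoopDensity_eq_sliceChart`** — `∫_{solidCyl} hoopDensity V = ∫_{s₁}^{s₂} ∫₀^{T₀} t⁻¹ ∫₀^{2π} (a² − b²)`
  (ns-sfl-p1 g7 `setIntegral_hoopDensity_solidCyl_eq` + ns-ezl-w3 g6 `intervalIntegral_hoopDensity_axisPt`);
* `sliceChart_hint₁`, `sliceChart_hint₂` — the two integrability inputs of `hoop_slice_le` for `V ∈ C¹`; `intervalIntegrable_sliceLHS`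
  — `σ`-integrability of the slice functional on `[s₁, s₂]` (strongly measurable parametric integral, bounded by `2πC·T₀`);
* `sliceChart_atom`, `sliceChart_atom_le` — the AXIS ATOM `E_σ(0) = π((V σe_z)₀² + (V σe_z)₁²) ≤ π‖V(σ•e_z)‖²`;
* `sliceChart_endFlux` — `∫₀^{T₀}∫₀^{2π} (a² + c²) = endFlux V σ T₀` (g7 `endFlux_eq`);
* `sliceChart_fourEntries_le_frobenius` — the four spent entries, `t`-weighted over the box, are `≤ ∫_{solidCyl} |DV|_F²`;
* **`hoop_slice_le_chart`** — ns-ezl-w2 g5's `hoop_slice_le_frame` (`…HoopSliceFrame`) INSTANTIATED with the chart data of a `C¹`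
  divergence-free `V` on the slice `σ`: `∫₀^{T₀} t⁻¹∫(a² − b²) ≤ ∫₀^{T₀} t∫(⟪DVf₁,f₀⟫² + ⟪DVf₁,f₁⟫²) + E_σ(0) − E_σ(T₀) − 2∫₀^{T₀}∫ P₁(a)·⟪DVe_z,e_z⟫`.

HONEST FRAME: tool lemmas for ONE functional inequality (HOOP-NOTE §4); nothing here is specific to Euler or Navier–Stokes;
19832 OPEN; NS regularity NOT proved.  [folklore (cylinder coordinates, Fubini)]
-/

noncomputable section

open MeasureTheory Set WithLp Metric Real Function
open scoped InnerProductSpace RealInnerProductSpace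

set_option linter.dupNamespace false

namespace Summit.NavierStokesRegularity.NavierStokesRegularity.Theorems.PowerGaugeEulerLiouville.HoopCore

open Literature.Analysis Literature.Analysis.FluidPDE Condenser

variable {V : EuclideanSpace ℝ (Fin 3) → EuclideanSpace ℝ (Fin 3)}

/-! ## The θ̂-column and the hoop functional of one slice -/

/-- **The θ̂-column in the chart**: with `aθ − b = t⟪DV R_θe₁, R_θe₀⟫` and `bθ + a = t⟪DV R_θe₁, R_θe₁⟫`,
`t⁻¹ ∫₀^{2π} [(aθ − b)² + (bθ + a)²] dθ = t ∫₀^{2π} [⟪DV R_θe₁, R_θe₀⟫² + ⟪DV R_θe₁, R_θe₁⟫²] dθ` (every real `t`; both sides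
vanish at `t = 0`). [folklore] -/
theorem thetaColumn_chart_eq (V : EuclideanSpace ℝ (Fin 3) → EuclideanSpace ℝ (Fin 3)) (s t : ℝ) :
    t⁻¹ * ∫ θ in (0 : ℝ)..2 * π,
        ((t * ⟪fderiv ℝ V (axisPt s t θ) (rotZ θ (EuclideanSpace.single (1 : Fin 3) (1 : ℝ))),
              rotZ θ (EuclideanSpace.single (0 : Fin 3) (1 : ℝ))⟫ +
            ⟪V (axisPt s t θ), rotZ θ (EuclideanSpace.single (1 : Fin 3) (1 : ℝ))⟫ -
            ⟪V (axisPt s t θ), rotZ θ (EuclideanSpace.single (1 : Fin 3) (1 : ℝ))⟫) ^ 2 +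
          (t * ⟪fderiv ℝ V (axisPt s t θ) (rotZ θ (EuclideanSpace.single (1 : Fin 3) (1 : ℝ))),
              rotZ θ (EuclideanSpace.single (1 : Fin 3) (1 : ℝ))⟫ -
            ⟪V (axisPt s t θ), rotZ θ (EuclideanSpace.single (0 : Fin 3) (1 : ℝ))⟫ +
            ⟪V (axisPt s t θ), rotZ θ (EuclideanSpace.single (0 : Fin 3) (1 : ℝ))⟫) ^ 2) =
      t * ∫ θ in (0 : ℝ)..2 * π,
        (⟪fderiv ℝ V (axisPt s t θ) (rotZ θ (EuclideanSpace.single (1 : Fin 3) (1 : ℝ))),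
            rotZ θ (EuclideanSpace.single (0 : Fin 3) (1 : ℝ))⟫ ^ 2 +
          ⟪fderiv ℝ V (axisPt s t θ) (rotZ θ (EuclideanSpace.single (1 : Fin 3) (1 : ℝ))),
            rotZ θ (EuclideanSpace.single (1 : Fin 3) (1 : ℝ))⟫ ^ 2) := by
  have e : ∀ θ : ℝ,
      (t * ⟪fderiv ℝ V (axisPt s t θ) (rotZ θ (EuclideanSpace.single (1 : Fin 3) (1 : ℝ))),
            rotZ θ (EuclideanSpace.single (0 : Fin 3) (1 : ℝ))⟫ +
          ⟪V (axisPt s t θ), rotZ θ (EuclideanSpace.single (1 : Fin 3) (1 : ℝ))⟫ -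
          ⟪V (axisPt s t θ), rotZ θ (EuclideanSpace.single (1 : Fin 3) (1 : ℝ))⟫) ^ 2 +
        (t * ⟪fderiv ℝ V (axisPt s t θ) (rotZ θ (EuclideanSpace.single (1 : Fin 3) (1 : ℝ))),
            rotZ θ (EuclideanSpace.single (1 : Fin 3) (1 : ℝ))⟫ -
          ⟪V (axisPt s t θ), rotZ θ (EuclideanSpace.single (0 : Fin 3) (1 : ℝ))⟫ +
          ⟪V (axisPt s t θ), rotZ θ (EuclideanSpace.single (0 : Fin 3) (1 : ℝ))⟫) ^ 2 =
      t ^ 2 * (⟪fderiv ℝ V (axisPt s t θ) (rotZ θ (EuclideanSpace.single (1 : Fin 3) (1 : ℝ))),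
            rotZ θ (EuclideanSpace.single (0 : Fin 3) (1 : ℝ))⟫ ^ 2 +
          ⟪fderiv ℝ V (axisPt s t θ) (rotZ θ (EuclideanSpace.single (1 : Fin 3) (1 : ℝ))),
            rotZ θ (EuclideanSpace.single (1 : Fin 3) (1 : ℝ))⟫ ^ 2) := fun θ => by ring
  simp_rw [e, intervalIntegral.integral_const_mul]
  rcases eq_or_ne t 0 with h | h
  · simp [h]
  · field_simp

/-- **The hoop integrand of one circle in the chart** (`t > 0`, `V` continuous):
`t⁻¹ ∫₀^{2π} (a² − b²) dθ = ∫₀^{2π} t · hoopDensity V (axisPt s t θ) dθ` (the atom is invisible after the azimuthal integration,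
`intervalIntegral_hoopDensity_axisPt`). [folklore] -/
theorem sliceLHS_integrand_eq (hV : Continuous V) (s : ℝ) {t : ℝ} (ht : 0 < t) :
    t⁻¹ * ∫ θ in (0 : ℝ)..2 * π,
        (⟪V (axisPt s t θ), rotZ θ (EuclideanSpace.single (0 : Fin 3) (1 : ℝ))⟫ ^ 2 -
          ⟪V (axisPt s t θ), rotZ θ (EuclideanSpace.single (1 : Fin 3) (1 : ℝ))⟫ ^ 2) =
      ∫ θ in (0 : ℝ)..2 * π, t * hoopDensity V (axisPt s t θ) := by
  rw [intervalIntegral.integral_const_mul, intervalIntegral_hoopDensity_axisPt hV s ht]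
  simp_rw [inner_rotZ_single_zero_eq_radialVelocity V s ht, inner_rotZ_single_one_eq_swirlVelocity V s ht]
  field_simp

/-- A uniform bound for the hoop integrand of one circle: if `t · |hoopDensity V (axisPt s t θ)| ≤ C` for all `θ` (`t > 0`),
then `‖t⁻¹ ∫₀^{2π} (a² − b²)‖ ≤ C · |2π − 0|`. [folklore] -/
theorem norm_sliceLHS_integrand_le (hV : Continuous V) (s : ℝ) {t C : ℝ} (ht : 0 < t)
    (hC : ∀ θ : ℝ, t * |hoopDensity V (axisPt s t θ)| ≤ C) :
    ‖t⁻¹ * ∫ θ in (0 : ℝ)..2 * π,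
        (⟪V (axisPt s t θ), rotZ θ (EuclideanSpace.single (0 : Fin 3) (1 : ℝ))⟫ ^ 2 -
          ⟪V (axisPt s t θ), rotZ θ (EuclideanSpace.single (1 : Fin 3) (1 : ℝ))⟫ ^ 2)‖ ≤ C * |2 * π - 0| := by
  rw [sliceLHS_integrand_eq hV s ht]
  refine intervalIntegral.norm_integral_le_of_norm_le_const fun θ _ => ?_
  rw [Real.norm_eq_abs, abs_mul, abs_of_pos ht]
  exact hC θ

/-- **THE HOOP FUNCTIONAL IN THE SLICE CHART** (`V ∈ C¹`, `s₁ ≤ s₂`, `T₀ > 0`):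
`∫_{solidCyl s₁ s₂ T₀} hoopDensity V = ∫_{s₁}^{s₂} ∫₀^{T₀} t⁻¹ ∫₀^{2π} (a² − b²) dθ dt dσ`,
`a = ⟪V(axisPt σ t θ), R_θe₀⟫`, `b = ⟪V(axisPt σ t θ), R_θe₁⟫` — the left side of `hoop_slice_le`, slice by slice. [folklore] -/
theorem setIntegral_hoopDensity_eq_sliceChart (hV : ContDiff ℝ 1 V) {s₁ s₂ T₀ : ℝ} (hs : s₁ ≤ s₂) (hT₀ : 0 < T₀) :
    ∫ y in solidCyl s₁ s₂ T₀, hoopDensity V y =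
      ∫ σ in s₁..s₂, ∫ t in (0 : ℝ)..T₀, t⁻¹ * ∫ θ in (0 : ℝ)..2 * π,
        (⟪V (axisPt σ t θ), rotZ θ (EuclideanSpace.single (0 : Fin 3) (1 : ℝ))⟫ ^ 2 -
          ⟪V (axisPt σ t θ), rotZ θ (EuclideanSpace.single (1 : Fin 3) (1 : ℝ))⟫ ^ 2) := by
  rw [setIntegral_hoopDensity_solidCyl_eq hV hs hT₀]
  refine intervalIntegral.integral_congr fun σ _ => intervalIntegral.integral_congr fun t ht => ?_
  rw [uIcc_of_le hT₀.le] at ht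
  rcases eq_or_lt_of_le ht.1 with h | h
  · simp only [← h, zero_mul, inv_zero]
  · rw [sliceLHS_integrand_eq hV.continuous σ h, intervalIntegral.integral_const_mul]

/-- **`hint₁` of `hoop_slice_le` for a `C¹` field**: the `t⁻¹`-weighted hoop integrand of the slice `σ` is interval-integrable
on `[0, T₀]` (bounded by `2π · C` on `(0, T₀]` via `exists_mul_abs_hoopDensity_le_solidCyl`, and measurable). [folklore] -/
theorem sliceChart_hint₁ (hV : ContDiff ℝ 1 V) (σ : ℝ) {T₀ : ℝ} (hT₀ : 0 < T₀) :
    IntervalIntegrable (fun t : ℝ => t⁻¹ * ∫ θ in (0 : ℝ)..2 * π,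
        (⟪V (axisPt σ t θ), rotZ θ (EuclideanSpace.single (0 : Fin 3) (1 : ℝ))⟫ ^ 2 -
          ⟪V (axisPt σ t θ), rotZ θ (EuclideanSpace.single (1 : Fin 3) (1 : ℝ))⟫ ^ 2)) volume 0 T₀ := by
  obtain ⟨C, hC⟩ := exists_mul_abs_hoopDensity_le_solidCyl hV σ σ hT₀
  have hVc := hV.continuous
  -- the integrand is measurable: `t⁻¹` times a continuous parametric integral
  have hF : Continuous fun p : ℝ × ℝ × ℝ =>
      ⟪V (axisPt p.1 p.2.1 p.2.2), rotZ p.2.2 (EuclideanSpace.single (0 : Fin 3) (1 : ℝ))⟫ ^ 2 -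
        ⟪V (axisPt p.1 p.2.1 p.2.2), rotZ p.2.2 (EuclideanSpace.single (1 : Fin 3) (1 : ℝ))⟫ ^ 2 :=
    ((continuous_sliceA hVc).pow 2).sub ((continuous_sliceB hVc).pow 2)
  have hI : Continuous fun t : ℝ => ∫ θ in (0 : ℝ)..2 * π,
      (⟪V (axisPt σ t θ), rotZ θ (EuclideanSpace.single (0 : Fin 3) (1 : ℝ))⟫ ^ 2 -
        ⟪V (axisPt σ t θ), rotZ θ (EuclideanSpace.single (1 : Fin 3) (1 : ℝ))⟫ ^ 2) :=
    intervalIntegral.continuous_parametric_intervalIntegral_of_continuous' (continuous_uncurry_slice hF σ) _ _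
  have hmeas : Measurable fun t : ℝ => t⁻¹ * ∫ θ in (0 : ℝ)..2 * π,
      (⟪V (axisPt σ t θ), rotZ θ (EuclideanSpace.single (0 : Fin 3) (1 : ℝ))⟫ ^ 2 -
        ⟪V (axisPt σ t θ), rotZ θ (EuclideanSpace.single (1 : Fin 3) (1 : ℝ))⟫ ^ 2) :=
    measurable_inv.mul hI.measurable
  rw [intervalIntegrable_iff_integrableOn_Ioc_of_le hT₀.le]
  refine Measure.integrableOn_of_bounded measure_Ioc_lt_top.ne hmeas.aestronglyMeasurable (M := C * |2 * π - 0|) ?_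
  rw [ae_restrict_iff' measurableSet_Ioc]
  refine ae_of_all _ fun t ht => ?_
  exact norm_sliceLHS_integrand_le hVc σ ht.1 fun θ => hC σ t θ le_rfl le_rfl ht.1 ht.2

/-- **`hint₂` of `hoop_slice_le` for a `C¹` field**: the `t⁻¹`-weighted θ̂-column integrand is interval-integrable on `[0, T₀]`
(it equals the continuous function `t ∫[⟪DV R_θe₁, R_θe₀⟫² + ⟪DV R_θe₁, R_θe₁⟫²]`, `thetaColumn_chart_eq`). [folklore] -/
theorem sliceChart_hint₂ (hV : ContDiff ℝ 1 V) (σ T₀ : ℝ) :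
    IntervalIntegrable (fun t : ℝ => t⁻¹ * ∫ θ in (0 : ℝ)..2 * π,
        ((t * ⟪fderiv ℝ V (axisPt σ t θ) (rotZ θ (EuclideanSpace.single (1 : Fin 3) (1 : ℝ))),
              rotZ θ (EuclideanSpace.single (0 : Fin 3) (1 : ℝ))⟫ +
            ⟪V (axisPt σ t θ), rotZ θ (EuclideanSpace.single (1 : Fin 3) (1 : ℝ))⟫ -
            ⟪V (axisPt σ t θ), rotZ θ (EuclideanSpace.single (1 : Fin 3) (1 : ℝ))⟫) ^ 2 +
          (t * ⟪fderiv ℝ V (axisPt σ t θ) (rotZ θ (EuclideanSpace.single (1 : Fin 3) (1 : ℝ))),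
              rotZ θ (EuclideanSpace.single (1 : Fin 3) (1 : ℝ))⟫ -
            ⟪V (axisPt σ t θ), rotZ θ (EuclideanSpace.single (0 : Fin 3) (1 : ℝ))⟫ +
            ⟪V (axisPt σ t θ), rotZ θ (EuclideanSpace.single (0 : Fin 3) (1 : ℝ))⟫) ^ 2)) volume 0 T₀ := by
  have e := fun t => thetaColumn_chart_eq V σ t
  simp_rw [e]
  have hF : Continuous fun p : ℝ × ℝ × ℝ =>
      ⟪fderiv ℝ V (axisPt p.1 p.2.1 p.2.2) (rotZ p.2.2 (EuclideanSpace.single (1 : Fin 3) (1 : ℝ))),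
          rotZ p.2.2 (EuclideanSpace.single (0 : Fin 3) (1 : ℝ))⟫ ^ 2 +
        ⟪fderiv ℝ V (axisPt p.1 p.2.1 p.2.2) (rotZ p.2.2 (EuclideanSpace.single (1 : Fin 3) (1 : ℝ))),
          rotZ p.2.2 (EuclideanSpace.single (1 : Fin 3) (1 : ℝ))⟫ ^ 2 :=
    ((continuous_sliceEntry hV continuous_rotZ_single_one continuous_rotZ_single_zero).pow 2).add
      ((continuous_sliceEntry hV continuous_rotZ_single_one continuous_rotZ_single_one).pow 2)
  have hI := intervalIntegral.continuous_parametric_intervalIntegral_of_continuous' (μ := volume)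
    (continuous_uncurry_slice hF σ) 0 (2 * π)
  exact (continuous_id.mul hI).intervalIntegrable _ _

/-- **`σ`-integrability of the slice functional**: for `V ∈ C¹`, `s₁ ≤ s₂`, `T₀ > 0`, the slice functional
`σ ↦ ∫₀^{T₀} t⁻¹ ∫₀^{2π} (a² − b²)` is interval-integrable on `[s₁, s₂]` (strongly measurable as a parametric integral of a
measurable function of `(σ, t)`, and bounded by `2π C · T₀`). [folklore] -/
theorem intervalIntegrable_sliceLHS (hV : ContDiff ℝ 1 V) {s₁ s₂ T₀ : ℝ} (hs : s₁ ≤ s₂) (hT₀ : 0 < T₀) :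
    IntervalIntegrable (fun σ : ℝ => ∫ t in (0 : ℝ)..T₀, t⁻¹ * ∫ θ in (0 : ℝ)..2 * π,
        (⟪V (axisPt σ t θ), rotZ θ (EuclideanSpace.single (0 : Fin 3) (1 : ℝ))⟫ ^ 2 -
          ⟪V (axisPt σ t θ), rotZ θ (EuclideanSpace.single (1 : Fin 3) (1 : ℝ))⟫ ^ 2)) volume s₁ s₂ := by
  obtain ⟨C, hC⟩ := exists_mul_abs_hoopDensity_le_solidCyl hV s₁ s₂ hT₀
  have hVc := hV.continuous
  -- the `(σ, t)`-integrand is measurable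
  have hF : Continuous fun p : ℝ × ℝ × ℝ =>
      ⟪V (axisPt p.1 p.2.1 p.2.2), rotZ p.2.2 (EuclideanSpace.single (0 : Fin 3) (1 : ℝ))⟫ ^ 2 -
        ⟪V (axisPt p.1 p.2.1 p.2.2), rotZ p.2.2 (EuclideanSpace.single (1 : Fin 3) (1 : ℝ))⟫ ^ 2 :=
    ((continuous_sliceA hVc).pow 2).sub ((continuous_sliceB hVc).pow 2)
  have hH : Continuous fun q : ℝ × ℝ => ∫ θ in (0 : ℝ)..2 * π,
      (⟪V (axisPt q.1 q.2 θ), rotZ θ (EuclideanSpace.single (0 : Fin 3) (1 : ℝ))⟫ ^ 2 -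
        ⟪V (axisPt q.1 q.2 θ), rotZ θ (EuclideanSpace.single (1 : Fin 3) (1 : ℝ))⟫ ^ 2) :=
    intervalIntegral.continuous_parametric_intervalIntegral_of_continuous' (continuous_uncurry_pair hF) _ _
  have hG : StronglyMeasurable fun q : ℝ × ℝ => q.2⁻¹ * ∫ θ in (0 : ℝ)..2 * π,
      (⟪V (axisPt q.1 q.2 θ), rotZ θ (EuclideanSpace.single (0 : Fin 3) (1 : ℝ))⟫ ^ 2 -
        ⟪V (axisPt q.1 q.2 θ), rotZ θ (EuclideanSpace.single (1 : Fin 3) (1 : ℝ))⟫ ^ 2) :=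
    (measurable_snd.inv.mul hH.measurable).stronglyMeasurable
  have hSM := MeasureTheory.StronglyMeasurable.integral_prod_right' (ν := volume.restrict (Ioc 0 T₀)) hG
  -- rewrite the slice functional as that parametric integral
  have heq : (fun σ : ℝ => ∫ t in (0 : ℝ)..T₀, t⁻¹ * ∫ θ in (0 : ℝ)..2 * π,
        (⟪V (axisPt σ t θ), rotZ θ (EuclideanSpace.single (0 : Fin 3) (1 : ℝ))⟫ ^ 2 -
          ⟪V (axisPt σ t θ), rotZ θ (EuclideanSpace.single (1 : Fin 3) (1 : ℝ))⟫ ^ 2)) =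
      fun σ : ℝ => ∫ t, (fun q : ℝ × ℝ => q.2⁻¹ * ∫ θ in (0 : ℝ)..2 * π,
        (⟪V (axisPt q.1 q.2 θ), rotZ θ (EuclideanSpace.single (0 : Fin 3) (1 : ℝ))⟫ ^ 2 -
          ⟪V (axisPt q.1 q.2 θ), rotZ θ (EuclideanSpace.single (1 : Fin 3) (1 : ℝ))⟫ ^ 2)) (σ, t)
          ∂(volume.restrict (Ioc 0 T₀)) := by
    funext σ
    rw [intervalIntegral.integral_of_le hT₀.le]
  rw [intervalIntegrable_iff_integrableOn_Ioc_of_le hs, heq]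
  refine Measure.integrableOn_of_bounded measure_Ioc_lt_top.ne hSM.aestronglyMeasurable
    (M := C * |2 * π - 0| * |T₀ - 0|) ?_
  rw [ae_restrict_iff' measurableSet_Ioc]
  refine ae_of_all _ fun σ hσ => ?_
  rw [← intervalIntegral.integral_of_le hT₀.le]
  refine intervalIntegral.norm_integral_le_of_norm_le_const fun t ht => ?_
  rw [uIoc_of_le hT₀.le] at ht
  exact norm_sliceLHS_integrand_le hVc σ ht.1 fun θ => hC σ t θ hσ.1.le hσ.2 ht.1 ht.2

/-! ### The axis atom and the end-disc flux -/

/-- **THE AXIS ATOM**: on the axis (`t = 0`) the slice component `a(σ, 0, θ) = ⟪V(σ e_z), R_θe₀⟫ = v₀ cos θ + v₁ sin θ` is a pure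
first mode, so the first-mode energy `E_σ(0)` of `hoop_slice_le` is `π (v₀² + v₁²)`, `v = V(σ • e_z)`. [folklore] -/
theorem sliceChart_atom (V : EuclideanSpace ℝ (Fin 3) → EuclideanSpace ℝ (Fin 3)) (σ : ℝ) :
    π⁻¹ * ((∫ y in (0 : ℝ)..2 * π,
        ⟪V (axisPt σ 0 y), rotZ y (EuclideanSpace.single (0 : Fin 3) (1 : ℝ))⟫ * Real.cos y) ^ 2 +
      (∫ y in (0 : ℝ)..2 * π,
        ⟪V (axisPt σ 0 y), rotZ y (EuclideanSpace.single (0 : Fin 3) (1 : ℝ))⟫ * Real.sin y) ^ 2) =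
      π * ((V (σ • eZ)) 0 ^ 2 + (V (σ • eZ)) 1 ^ 2) := by
  simp_rw [axisPt_radius_zero, inner_rotZ_single_zero]
  exact firstMode_energy_of_firstMode _ _

/-- The axis atom is at most `π ‖V(σ • e_z)‖²` (the form in `HoopCore.HoopInequality`). [folklore] -/
theorem sliceChart_atom_le (V : EuclideanSpace ℝ (Fin 3) → EuclideanSpace ℝ (Fin 3)) (σ : ℝ) :
    π⁻¹ * ((∫ y in (0 : ℝ)..2 * π,
        ⟪V (axisPt σ 0 y), rotZ y (EuclideanSpace.single (0 : Fin 3) (1 : ℝ))⟫ * Real.cos y) ^ 2 +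
      (∫ y in (0 : ℝ)..2 * π,
        ⟪V (axisPt σ 0 y), rotZ y (EuclideanSpace.single (0 : Fin 3) (1 : ℝ))⟫ * Real.sin y) ^ 2) ≤
      π * ‖V (σ • eZ)‖ ^ 2 := by
  rw [sliceChart_atom]
  exact mul_le_mul_of_nonneg_left (Wei2016.sq_add_sq_le_norm_sq _) Real.pi_pos.le

/-- **THE END-DISC FLUX IN THE SLICE CHART** (`V` continuous, `T₀ > 0`):
`∫₀^{T₀} ∫₀^{2π} (a² + c²)(σ, t, θ) dθ dt = endFlux V σ T₀` (`a = V_r` for `t > 0`, `c = V_z`; g7 `endFlux_eq`). [folklore] -/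
theorem sliceChart_endFlux (hV : Continuous V) (σ : ℝ) {T₀ : ℝ} (hT₀ : 0 < T₀) :
    ∫ t in (0 : ℝ)..T₀, ∫ θ in (0 : ℝ)..2 * π,
        (⟪V (axisPt σ t θ), rotZ θ (EuclideanSpace.single (0 : Fin 3) (1 : ℝ))⟫ ^ 2 +
          (axialVelocity V (axisPt σ t θ)) ^ 2) = endFlux V σ T₀ := by
  rw [endFlux_eq hV σ hT₀]
  refine intervalIntegral.integral_congr_ae (ae_of_all _ fun t ht => ?_)
  rw [uIoc_of_le hT₀.le] at ht
  simp_rw [inner_rotZ_single_zero_eq_radialVelocity V σ ht.1]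

/-! ### The Frobenius side: the four spent entries, integrated over the solid cylinder -/

/-- `(σ, t) ↦ t · ∫₀^{2π} F(σ, t, θ) dθ` is continuous for jointly continuous `F`. [folklore] -/
theorem continuous_mul_intervalIntegral_slice {F : ℝ × ℝ × ℝ → ℝ} (hF : Continuous F) :
    Continuous fun q : ℝ × ℝ => q.2 * ∫ θ in (0 : ℝ)..2 * π, F (q.1, q.2, θ) :=
  continuous_snd.mul
    (intervalIntegral.continuous_parametric_intervalIntegral_of_continuous' (continuous_uncurry_pair hF) _ _)

/-- **THE FROBENIUS SIDE IN THE SLICE CHART** (`V ∈ C¹`, `s₁ ≤ s₂`, `0 ≤ T₀`): the four spent entries, weighted by `t` and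
integrated over the coordinate box, are at most the Frobenius energy of the solid cylinder:
`∫_{s₁}^{s₂} ∫₀^{T₀} t ∫₀^{2π} [⟪DV R_θe₁, R_θe₀⟫² + ⟪DV R_θe₁, R_θe₁⟫² + ⟪DV R_θe₁, e_z⟫² + ⟪DV e_z, R_θe₀⟫²] ≤ ∫_{solidCyl} |DV|_F²`
(`fourEntries_le_frobeniusNormSq` pointwise + g7 `setIntegral_frobeniusNormSq_fderiv_solidCyl_eq`). [folklore] -/
theorem sliceChart_fourEntries_le_frobenius (hV : ContDiff ℝ 1 V) {s₁ s₂ T₀ : ℝ} (hs : s₁ ≤ s₂) (hT₀ : 0 ≤ T₀) :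
    ∫ σ in s₁..s₂, ∫ t in (0 : ℝ)..T₀, t * ∫ θ in (0 : ℝ)..2 * π,
        (⟪fderiv ℝ V (axisPt σ t θ) (rotZ θ (EuclideanSpace.single (1 : Fin 3) (1 : ℝ))),
            rotZ θ (EuclideanSpace.single (0 : Fin 3) (1 : ℝ))⟫ ^ 2 +
          ⟪fderiv ℝ V (axisPt σ t θ) (rotZ θ (EuclideanSpace.single (1 : Fin 3) (1 : ℝ))),
            rotZ θ (EuclideanSpace.single (1 : Fin 3) (1 : ℝ))⟫ ^ 2 +
          ⟪fderiv ℝ V (axisPt σ t θ) (rotZ θ (EuclideanSpace.single (1 : Fin 3) (1 : ℝ))), eZ⟫ ^ 2 +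
          ⟪fderiv ℝ V (axisPt σ t θ) eZ, rotZ θ (EuclideanSpace.single (0 : Fin 3) (1 : ℝ))⟫ ^ 2) ≤
      ∫ y in solidCyl s₁ s₂ T₀, frobeniusNormSq (fderiv ℝ V y) := by
  rw [setIntegral_frobeniusNormSq_fderiv_solidCyl_eq hV hs hT₀]
  -- the two `(σ, t, θ)`-integrands are continuous
  have hF : Continuous fun p : ℝ × ℝ × ℝ =>
      ⟪fderiv ℝ V (axisPt p.1 p.2.1 p.2.2) (rotZ p.2.2 (EuclideanSpace.single (1 : Fin 3) (1 : ℝ))),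
          rotZ p.2.2 (EuclideanSpace.single (0 : Fin 3) (1 : ℝ))⟫ ^ 2 +
        ⟪fderiv ℝ V (axisPt p.1 p.2.1 p.2.2) (rotZ p.2.2 (EuclideanSpace.single (1 : Fin 3) (1 : ℝ))),
          rotZ p.2.2 (EuclideanSpace.single (1 : Fin 3) (1 : ℝ))⟫ ^ 2 +
        ⟪fderiv ℝ V (axisPt p.1 p.2.1 p.2.2) (rotZ p.2.2 (EuclideanSpace.single (1 : Fin 3) (1 : ℝ))), eZ⟫ ^ 2 +
        ⟪fderiv ℝ V (axisPt p.1 p.2.1 p.2.2) eZ, rotZ p.2.2 (EuclideanSpace.single (0 : Fin 3) (1 : ℝ))⟫ ^ 2 :=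
    ((((continuous_sliceEntry hV continuous_rotZ_single_one continuous_rotZ_single_zero).pow 2).add
      ((continuous_sliceEntry hV continuous_rotZ_single_one continuous_rotZ_single_one).pow 2)).add
      ((continuous_sliceEntry hV continuous_rotZ_single_one continuous_const).pow 2)).add
      ((continuous_sliceEntry hV continuous_const continuous_rotZ_single_zero).pow 2)
  have hG : Continuous fun p : ℝ × ℝ × ℝ => frobeniusNormSq (fderiv ℝ V (axisPt p.1 p.2.1 p.2.2)) := by
    have hc : Continuous fun y => frobeniusNormSq (fderiv ℝ V y) := by
      unfold frobeniusNormSq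
      exact continuous_finsetSum _ fun i _ =>
        (((hV.continuous_fderiv one_ne_zero).clm_apply continuous_const).norm).pow 2
    exact hc.comp continuous_axisPt
  have hFq := continuous_mul_intervalIntegral_slice hF
  have hGq := continuous_mul_intervalIntegral_slice hG
  -- monotonicity in `σ`, then in `t`, then in `θ`
  refine intervalIntegral.integral_mono_on hs
    ((intervalIntegral.continuous_parametric_intervalIntegral_of_continuous' hFq _ _).intervalIntegrable _ _)
    ((intervalIntegral.continuous_parametric_intervalIntegral_of_continuous' hGq _ _).intervalIntegrable _ _)
    fun σ _ => ?_
  refine intervalIntegral.integral_mono_on hT₀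
    ((hFq.comp (continuous_const.prodMk continuous_id)).intervalIntegrable _ _)
    ((hGq.comp (continuous_const.prodMk continuous_id)).intervalIntegrable _ _)
    fun t ht => ?_
  refine mul_le_mul_of_nonneg_left ?_ ht.1
  refine intervalIntegral.integral_mono_on (by positivity)
    ((continuous_uncurry_slice hF σ |>.comp (continuous_const.prodMk continuous_id)).intervalIntegrable _ _)
    ((continuous_uncurry_slice hG σ |>.comp (continuous_const.prodMk continuous_id)).intervalIntegrable _ _)
    fun θ _ => ?_
  exact fourEntries_le_frobeniusNormSq (fderiv ℝ V (axisPt σ t θ)) θ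

/-! ### The slice inequality for a `C¹` divergence-free field -/

/-- **THE HOOP LEVER ON ONE SLICE OF A `C¹` DIVERGENCE-FREE FIELD** (ns-ezl-w2 g5's `hoop_slice_le_frame` instantiated with the
slice chart): for `V ∈ C¹` with `div V = 0`, every height `σ` and `T₀ > 0`,
`∫₀^{T₀} t⁻¹∫₀^{2π}(a² − b²) ≤ ∫₀^{T₀} t∫₀^{2π}(⟪DV R_θe₁, R_θe₀⟫² + ⟪DV R_θe₁, R_θe₁⟫²) + E_σ(0) − E_σ(T₀)
  − 2∫₀^{T₀}∫₀^{2π} P₁(a(σ,t,·))(θ) · ⟪DV e_z, e_z⟫`,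
`a = ⟪V(axisPt σ t θ), R_θe₀⟫`, `b = ⟪V(axisPt σ t θ), R_θe₁⟫`, `E_σ(t) = π⁻¹((∫a cos)² + (∫a sin)²)`. [HOOP-NOTE §4] -/
theorem hoop_slice_le_chart (hV : ContDiff ℝ 1 V) (hdiv : ∀ y, VectorCalculus.divergence V y = 0) (σ : ℝ) {T₀ : ℝ}
    (hT₀ : 0 < T₀) :
    ∫ t in (0 : ℝ)..T₀, t⁻¹ * ∫ θ in (0 : ℝ)..2 * π,
        (⟪V (axisPt σ t θ), rotZ θ (EuclideanSpace.single (0 : Fin 3) (1 : ℝ))⟫ ^ 2 -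
          ⟪V (axisPt σ t θ), rotZ θ (EuclideanSpace.single (1 : Fin 3) (1 : ℝ))⟫ ^ 2) ≤
      (∫ t in (0 : ℝ)..T₀, t * ∫ θ in (0 : ℝ)..2 * π,
          (⟪fderiv ℝ V (axisPt σ t θ) (rotZ θ (EuclideanSpace.single (1 : Fin 3) (1 : ℝ))),
              rotZ θ (EuclideanSpace.single (0 : Fin 3) (1 : ℝ))⟫ ^ 2 +
            ⟪fderiv ℝ V (axisPt σ t θ) (rotZ θ (EuclideanSpace.single (1 : Fin 3) (1 : ℝ))),
              rotZ θ (EuclideanSpace.single (1 : Fin 3) (1 : ℝ))⟫ ^ 2))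
        + π⁻¹ * ((∫ y in (0 : ℝ)..2 * π,
            ⟪V (axisPt σ 0 y), rotZ y (EuclideanSpace.single (0 : Fin 3) (1 : ℝ))⟫ * Real.cos y) ^ 2 +
          (∫ y in (0 : ℝ)..2 * π,
            ⟪V (axisPt σ 0 y), rotZ y (EuclideanSpace.single (0 : Fin 3) (1 : ℝ))⟫ * Real.sin y) ^ 2)
        - π⁻¹ * ((∫ y in (0 : ℝ)..2 * π,
            ⟪V (axisPt σ T₀ y), rotZ y (EuclideanSpace.single (0 : Fin 3) (1 : ℝ))⟫ * Real.cos y) ^ 2 +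
          (∫ y in (0 : ℝ)..2 * π,
            ⟪V (axisPt σ T₀ y), rotZ y (EuclideanSpace.single (0 : Fin 3) (1 : ℝ))⟫ * Real.sin y) ^ 2)
        - 2 * ∫ t in (0 : ℝ)..T₀, ∫ θ in (0 : ℝ)..2 * π,
            (π⁻¹ * (∫ y in (0 : ℝ)..2 * π,
                ⟪V (axisPt σ t y), rotZ y (EuclideanSpace.single (0 : Fin 3) (1 : ℝ))⟫ * Real.cos y) * Real.cos θ +
              π⁻¹ * (∫ y in (0 : ℝ)..2 * π,
                ⟪V (axisPt σ t y), rotZ y (EuclideanSpace.single (0 : Fin 3) (1 : ℝ))⟫ * Real.sin y) * Real.sin θ) *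
              ⟪fderiv ℝ V (axisPt σ t θ) eZ, eZ⟫ := by
  have hVd : Differentiable ℝ V := hV.differentiable one_ne_zero
  have hVc : Continuous V := hV.continuous
  exact hoop_slice_le_frame
    (a := fun t θ => ⟪V (axisPt σ t θ), rotZ θ (EuclideanSpace.single (0 : Fin 3) (1 : ℝ))⟫)
    (b := fun t θ => ⟪V (axisPt σ t θ), rotZ θ (EuclideanSpace.single (1 : Fin 3) (1 : ℝ))⟫)
    (mr := fun t θ => ⟪fderiv ℝ V (axisPt σ t θ) (rotZ θ (EuclideanSpace.single (1 : Fin 3) (1 : ℝ))),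
      rotZ θ (EuclideanSpace.single (0 : Fin 3) (1 : ℝ))⟫)
    (mθ := fun t θ => ⟪fderiv ℝ V (axisPt σ t θ) (rotZ θ (EuclideanSpace.single (1 : Fin 3) (1 : ℝ))),
      rotZ θ (EuclideanSpace.single (1 : Fin 3) (1 : ℝ))⟫)
    (ad := fun t θ => ⟪fderiv ℝ V (axisPt σ t θ) (rotZ θ (EuclideanSpace.single (0 : Fin 3) (1 : ℝ))),
      rotZ θ (EuclideanSpace.single (0 : Fin 3) (1 : ℝ))⟫)
    (β := fun t θ => ⟪fderiv ℝ V (axisPt σ t θ) eZ, eZ⟫) hT₀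
    (fun t θ => hasDerivAt_sliceA_angle hVd σ t θ) (fun t θ => hasDerivAt_sliceB_angle hVd σ t θ)
    (fun t θ => hasDerivAt_sliceA_radius hVd σ t θ)
    (continuous_uncurry_slice (continuous_sliceA hVc) σ) (continuous_uncurry_slice (continuous_sliceB hVc) σ)
    (continuous_uncurry_slice (continuous_sliceEntry hV continuous_rotZ_single_one continuous_rotZ_single_zero) σ)
    (continuous_uncurry_slice (continuous_sliceEntry hV continuous_rotZ_single_one continuous_rotZ_single_one) σ)
    (continuous_uncurry_slice (continuous_sliceEntry hV continuous_rotZ_single_zero continuous_rotZ_single_zero) σ)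
    (continuous_uncurry_slice (continuous_sliceEntry hV continuous_const continuous_const) σ)
    (fun t => by simp only [axisPt_two_pi, rotZ_two_pi_single_zero])
    (fun t => by simp only [axisPt_two_pi, rotZ_two_pi_single_one])
    (fun t θ => by
      have h := hdiv (axisPt σ t θ)
      rw [divergence_eq_rotFrame V _ θ] at h
      linarith)
    (sliceChart_hint₁ hV σ hT₀)

end Summit.NavierStokesRegularity.NavierStokesRegularity.Theorems.PowerGaugeEulerLiouville.HoopCore

end
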